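import Summits.HodgeConjecture.CorCM.SexticCMThreefoldCurvePowersHodgeOfMarkman
import Summits.HodgeConjecture.CorCM.CMEllipticCurveTimesSimpleCMThreefold
import Summits.HodgeConjecture.CorCM.DihedralSexticPairWeights
import Summits.HodgeConjecture.CorCM.BiproductSlotsDomination
import HarnessLib

/-!
# MULTI-FIELD WEIL ENGINE — ANY CM ELLIPTIC CURVE × ANY SIMPLE CM ABELIAN THREEFOLD: the Hodge conjecture for EVERY product of copies `E^a × T^b`, given ONLY
# Markman's fourfold theorem (Moonen–Zarhin's dichotomy (0.1) with the Weil side discharged modulo Markman)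

Cell `pub-hodgecm2` (COR-CM), seat b30 gen 31 (2026-08-24); count-neutral own lane MULTI-FIELD WEIL ENGINE (stem `MultiFieldWeil*`).  Theorems only; no definition, no
named fact, no `sorry`.  HONEST FRAMING: conditional on the displayed Markman fourfold binder only (in one of the two cases); `HC_CM` is NOT proved and not asserted.

THE STATEMENT (**`hodgeConjectureFor_biproduct_comp_vec_of_cmCurve_simpleThreefold_of_markman`**).  `E ⊨ (k; Ψ)` a CM elliptic curve (`k` an imaginary quadratic
field), `T ⊨ (K; Φ)` a SIMPLE abelian threefold with CM by a sextic CM field `K` — NOTHING assumed on the relation between `k` and `K`.  Then for every `κ : Fin N → Fin 2`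
— every `E^a × T^b` — the Hodge conjecture holds for `⨁_j ![E, T] (κ j)`, GIVEN ONLY `Markman2025_weilClasses_algebraic_abelianFourfold`; likewise for `E × T`, for every
abelian variety dominated by ∕ isogenous to such a product, and for all powers of the latter.  Moonen–Zarhin (0.1): if `k` does NOT embed in `K` (case (4)) then
`B•(Xⁿ) = D•(Xⁿ)` for all powers of `X = E × T` — UNCONDITIONAL, the tree's `hodgeConjectureFor_prod_of_forall_isEmpty_of_isSimple` (b16, Hazama–Murty for the
nondegenerate family); if `k ↪ K` (case (a)) the Hodge ring needs the Weil classes `W_k` of the fourfold `E × T` — algebraic by Markman — and gen 15's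
`SexticCMThreefold.hodgeConjectureFor_biproduct_comp_vec_of_markman` covers every product of copies.

[cite: MoonenZarhin1999LowDim, Thm. (0.1) (a), (1), (4)] [cite: Markman2025SurveySecant, Thm. 1.2] [cite: Gordon1999HodgeAVSurvey, §3 Theorem, 7.5–7.7]
[cite: MumfordAV1970, §19 Thm. 1 and p. 169]

## References
* [MoonenZarhin1999LowDim] B. Moonen, Yu. Zarhin, *Hodge classes on abelian varieties of low dimension*, Math. Ann. 315 (1999), Thm. (0.1) (abelian FOURFOLDS `X = X₁ × X₂`, `X₁` an elliptic curve: cases (a)/(b), items (1)–(4)); gen-31 text cited (0.2) — locator corrected gen 32 (ring-2 P-lit-130-3), statements unchanged.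
  [Markman2025SurveySecant] E. Markman, arXiv:2509.23403, Thm. 1.2.  [Gordon1999HodgeAVSurvey] B. B. Gordon, *A survey of the Hodge conjecture for abelian varieties*,
  §3, 7.5–7.7.  [MumfordAV1970] D. Mumford, *Abelian Varieties*, §19.
-/

noncomputable section

open CategoryTheory CategoryTheory.Limits NumberField

namespace Summit.HodgeConjecture.CorCM.MultiFieldWeil

open Literature.AlgebraicGeometry Literature.AlgebraicGeometry.Motives Literature.AlgebraicGeometry.HodgeTheory
open Literature.AlgebraicGeometry.ComplexMultiplication (IsCMTypeRealisation)
open Literature.AlgebraicTopology.SingularHomology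

open scoped Classical

variable {k K : Type} [Field k] [NumberField k] [IsCMField k] [Field K] [NumberField K] [IsCMField K] {N : ℕ}
  {E T : AbelianVariety ℂ} {Ψ : CMType k} {Φ : CMType K}
  {ιE : 𝓞 k →+* End E} {θE : k →+* Module.End ℂ (complexBetti E.X 1)}
  {ιT : 𝓞 K →+* End T} {θT : K →+* Module.End ℂ (complexBetti T.X 1)}

/-- **MOONEN–ZARHIN (0.1) (4), every product of copies: NO embedding `k ↪ K`** — for a CM elliptic curve `E ⊨ (k; Ψ)` and a SIMPLE CM threefold `T ⊨ (K; Φ)` with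
`Hom(k, K) = ∅` the Hodge conjecture holds on every `E^a × T^b`, UNCONDITIONALLY (b16's `hodgeConjectureFor_prod_of_forall_isEmpty_of_isSimple` on the family `(k, K)`).
[cite: MoonenZarhin1999LowDim, Thm. (0.1) (4)] [cite: Gordon1999HodgeAVSurvey, §3 Theorem] -/
theorem hodgeConjectureFor_biproduct_comp_vec_of_cmCurve_simpleThreefold_of_isEmpty (h2 : Module.finrank ℚ k = 2) (h6 : Module.finrank ℚ K = 6)
    (hE : IsCMTypeRealisation Ψ E ιE θE) (hT : IsCMTypeRealisation Φ T ιT θT) (hS : T.IsSimple) (hkK : IsEmpty (k →+* K)) (κ : Fin N → Fin 2) :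
    HodgeConjectureFor (⨁ fun j => (![E, T] : Fin 2 → AbelianVariety ℂ) (κ j)).dim (⨁ fun j => (![E, T] : Fin 2 → AbelianVariety ℂ) (κ j)).X := by
  -- the family of fields `(k, K)` with its instances (all identifications are definitional)
  let Kf : Fin 2 → Type := Fin.cons k (Fin.cons K finZeroElim)
  letI instF : ∀ j, Field (Kf j) := Fin.cons ‹Field k› (Fin.cons ‹Field K› finZeroElim)
  letI instN : ∀ j, NumberField (Kf j) := Fin.cons ‹NumberField k› (Fin.cons ‹NumberField K› finZeroElim)
  haveI instC : ∀ j, IsCMField (Kf j) := Fin.cons ‹IsCMField k› (Fin.cons ‹IsCMField K› finZeroElim)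
  let Φf : ∀ j : Fin 2, CMType (Kf j) := Fin.cons Ψ (Fin.cons Φ finZeroElim)
  let ιf : ∀ j : Fin 2, 𝓞 (Kf j) →+* End ((![E, T] : Fin 2 → AbelianVariety ℂ) j) := Fin.cons ιE (Fin.cons ιT finZeroElim)
  let θf : ∀ j : Fin 2, Kf j →+* Module.End ℂ (complexBetti ((![E, T] : Fin 2 → AbelianVariety ℂ) j).X 1) := Fin.cons θE (Fin.cons θT finZeroElim)
  have hA : ∀ j, IsCMTypeRealisation (Φf j) ((![E, T] : Fin 2 → AbelianVariety ℂ) j) (ιf j) (θf j) := Fin.cons hE (Fin.cons hT finZeroElim)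
  have hdimT : T.dim = 3 := by rw [AndreProductForm.dim_eq_of_isCMTypeRealisation hT, h6]
  refine hodgeConjectureFor_prod_of_forall_isEmpty_of_isSimple (K := Kf) (A := (![E, T] : Fin 2 → AbelianVariety ℂ)) (Φ := Φf) (ι := ιf) (θ := θf)
    (1 : Fin 2) (fun j hj => ?_) hA (fun i j hi hj hij => ?_) hS ?_ ?_ (fun a ha => ?_) κ
  · fin_cases j
    · exact h2
    · exact absurd rfl hj
  · fin_cases i <;> fin_cases j
    · exact absurd rfl hij
    · exact absurd rfl hj
    · exact absurd rfl hi
    · exact absurd rfl hij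
  · show T.dim ≠ 1
    rw [hdimT]
    norm_num
  · show T.dim ≤ 3
    rw [hdimT]
  · fin_cases a
    · exact hkK
    · exact absurd rfl ha

/-- **MAIN THEOREM — ANY CM ELLIPTIC CURVE × ANY SIMPLE CM ABELIAN THREEFOLD, given ONLY Markman's fourfold theorem.**  `E ⊨ (k; Ψ)` a CM elliptic curve, `T ⊨ (K; Φ)` a
SIMPLE abelian threefold with CM by a sextic CM field — nothing assumed on `k` versus `K`.  Then the Hodge conjecture holds for `⨁_j ![E, T] (κ j)` for EVERY
`κ : Fin N → Fin 2` (every `E^a × T^b`), GIVEN ONLY `Markman2025_weilClasses_algebraic_abelianFourfold` (used only when `k ↪ K`, Moonen–Zarhin's case (a) — the case with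
the Weil classes `W_k`; case (4) is unconditional).  `HC_CM` is NOT asserted. [cite: MoonenZarhin1999LowDim, Thm. (0.1) (a), (1), (4)] [cite: Markman2025SurveySecant, Thm. 1.2] -/
theorem hodgeConjectureFor_biproduct_comp_vec_of_cmCurve_simpleThreefold_of_markman (hW4 : Markman2025_weilClasses_algebraic_abelianFourfold)
    (h2 : Module.finrank ℚ k = 2) (h6 : Module.finrank ℚ K = 6) (hE : IsCMTypeRealisation Ψ E ιE θE) (hT : IsCMTypeRealisation Φ T ιT θT) (hS : T.IsSimple)
    (κ : Fin N → Fin 2) :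
    HodgeConjectureFor (⨁ fun j => (![E, T] : Fin 2 → AbelianVariety ℂ) (κ j)).dim (⨁ fun j => (![E, T] : Fin 2 → AbelianVariety ℂ) (κ j)).X := by
  by_cases hkK : IsEmpty (k →+* K)
  · exact hodgeConjectureFor_biproduct_comp_vec_of_cmCurve_simpleThreefold_of_isEmpty h2 h6 hE hT hS hkK κ
  · obtain ⟨i⟩ := not_isEmpty_iff.1 hkK
    exact SexticCMThreefold.hodgeConjectureFor_biproduct_comp_vec_of_markman hW4 h6 h2 i hE hT hS κ

/-- **`E × T` itself**, for any CM elliptic curve and any simple CM threefold, given only Markman's fourfold theorem. [cite: MoonenZarhin1999LowDim, Thm. (0.1)]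
[cite: Markman2025SurveySecant, Thm. 1.2] -/
theorem hodgeConjectureFor_prod_of_cmCurve_simpleThreefold_of_markman (hW4 : Markman2025_weilClasses_algebraic_abelianFourfold)
    (h2 : Module.finrank ℚ k = 2) (h6 : Module.finrank ℚ K = 6) (hE : IsCMTypeRealisation Ψ E ιE θE) (hT : IsCMTypeRealisation Φ T ιT θT) (hS : T.IsSimple) :
    HodgeConjectureFor (E.prod T).dim (E.prod T).X :=
  PairWeights.hodgeConjectureFor_prod_of_biproduct (A := (![E, T] : Fin 2 → AbelianVariety ℂ))
    (hodgeConjectureFor_biproduct_comp_vec_of_cmCurve_simpleThreefold_of_markman hW4 h2 h6 hE hT hS (id : Fin 2 → Fin 2))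

/-- **Dominated form**: every abelian variety dominated by some `E^a × T^b` (everything isogenous to such a product, every abelian subvariety or quotient of one).
[cite: Markman2025SurveySecant, Thm. 1.2] [cite: MumfordAV1970, §19 Thm. 1 and p. 169] -/
theorem hodgeConjectureFor_of_avDominatedBy_comp_vec_of_cmCurve_simpleThreefold_of_markman (hW4 : Markman2025_weilClasses_algebraic_abelianFourfold)
    (h2 : Module.finrank ℚ k = 2) (h6 : Module.finrank ℚ K = 6) (hE : IsCMTypeRealisation Ψ E ιE θE) (hT : IsCMTypeRealisation Φ T ιT θT) (hS : T.IsSimple)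
    (κ : Fin N → Fin 2) {X : AbelianVariety ℂ} (hX : Domination.AVDominatedBy X (⨁ fun j => (![E, T] : Fin 2 → AbelianVariety ℂ) (κ j))) :
    HodgeConjectureFor X.dim X.X :=
  Domination.hodgeConjectureFor_of_avDominatedBy (hodgeConjectureFor_biproduct_comp_vec_of_cmCurve_simpleThreefold_of_markman hW4 h2 h6 hE hT hS κ) hX

/-- **Every abelian variety ISOGENOUS TO A PRODUCT OF COPIES of `E` and `T`** (any finite index type). [cite: Markman2025SurveySecant, Thm. 1.2] [cite: MumfordAV1970, §19] -/
theorem hodgeConjectureFor_of_isIsogenous_biproduct_comp_of_cmCurve_simpleThreefold_of_markman (hW4 : Markman2025_weilClasses_algebraic_abelianFourfold)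
    (h2 : Module.finrank ℚ k = 2) (h6 : Module.finrank ℚ K = 6) (hE : IsCMTypeRealisation Ψ E ιE θE) (hT : IsCMTypeRealisation Φ T ιT θT) (hS : T.IsSimple)
    {J : Type} [Fintype J] (cls : J → Fin 2) {X : AbelianVariety ℂ}
    (hX : AbelianVariety.IsIsogenous X (⨁ fun j => (![E, T] : Fin 2 → AbelianVariety ℂ) (cls j))) : HodgeConjectureFor X.dim X.X := by
  classical
  let ε : Fin (Fintype.card J) ≃ J := (Fintype.equivFin J).symm
  have e : (⨁ fun j => (![E, T] : Fin 2 → AbelianVariety ℂ) (cls j)) ≅ ⨁ fun l => (![E, T] : Fin 2 → AbelianVariety ℂ) (cls (ε l)) :=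
    (biproduct.reindex ε fun j => (![E, T] : Fin 2 → AbelianVariety ℂ) (cls j)).symm
  exact hodgeConjectureFor_of_avDominatedBy_comp_vec_of_cmCurve_simpleThreefold_of_markman hW4 h2 h6 hE hT hS (fun l => cls (ε l))
    (Domination.AVDominatedBy.of_isIsogenous hX ((Domination.AVDominatedBy.refl _).of_iso_right e))

/-- **… and ALL POWERS of such an abelian variety** (`X ∼` a product of copies of `E`, `T` ⟹ `HodgeConjectureFor (X^{N+1})` for every `N`).
[cite: Markman2025SurveySecant, Thm. 1.2] [cite: Gordon1999HodgeAVSurvey, 7.6.1] [cite: MumfordAV1970, §19] -/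
theorem hodgeConjectureFor_powSucc_of_isIsogenous_biproduct_comp_of_cmCurve_simpleThreefold_of_markman
    (hW4 : Markman2025_weilClasses_algebraic_abelianFourfold)
    (h2 : Module.finrank ℚ k = 2) (h6 : Module.finrank ℚ K = 6) (hE : IsCMTypeRealisation Ψ E ιE θE) (hT : IsCMTypeRealisation Φ T ιT θT) (hS : T.IsSimple)
    {J : Type} [Fintype J] (cls : J → Fin 2) {X : AbelianVariety ℂ}
    (hX : AbelianVariety.IsIsogenous X (⨁ fun j => (![E, T] : Fin 2 → AbelianVariety ℂ) (cls j))) (M : ℕ) :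
    HodgeConjectureFor (X.powSucc M).dim (X.powSucc M).X := by
  obtain ⟨n, ρ, hdom⟩ := exists_avDominatedBy_powSucc_biproduct_slots_of_isIsogenous hX M
  exact hodgeConjectureFor_of_avDominatedBy_comp_vec_of_cmCurve_simpleThreefold_of_markman hW4 h2 h6 hE hT hS ρ hdom

end Summit.HodgeConjecture.CorCM.MultiFieldWeil

end
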